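import Literature.NumberTheory.Transcendental.ExtrapolationScaled
import Literature.NumberTheory.Transcendental.BakerEngine
import HarnessLib

/-!
# Vanishing at the new points and the engine, with the scaled extrapolation estimate

Topic: `Literature/NumberTheory/Transcendental`. Plan item W4/S5 (refinement) of the unit
`provefact-Literature.NumberTheory.Transcendental.H-b596640137`. The versions of
`NewPoints.NumCond` / `NewPoints.vanishesAlong_newPoints` / `BakerEngine.engine` built on the
scaled extrapolation estimate `ExtrapolationScaled.norm_extrapFun_grid_le₂`, whose loss in the
order `k` is `k!·(kX+1)^k` instead of `e^{C·D·k²X²}` (the latter is not payable by any admissible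
parameters in low dimension). PROVED: `BakerData.NumCond₂` (the numerical condition),
`BakerData.vanishesAlong_newPoints₂`, `BakerData.engine₂`.

## References

* A. Baker, G. Wüstholz, *Logarithmic Forms and Diophantine Geometry*, CUP 2007, §6.8 (p. 119).
-/

noncomputable section

open Complex MvPolynomial Finset NumberField
open scoped PeriodPair

namespace Literature.NumberTheory.Transcendental

namespace GaGmE

namespace Std

namespace BakerData

variable {β γ δ : Type} [Fintype β] [Fintype γ] [Fintype δ] [DecidableEq γ]
variable [DecidableEq β] [DecidableEq δ] (B : BakerData β γ δ)

/-- **The numerical condition (scaled form)**: for all `s ≤ S₁`, `k < T'`,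
`k!·(kX+1)^k·#U·H_ξ·e^{C_Θ(1+(R‖v‖+1)²)·D}·(2(s+S₀)/R)^{(T-k)(S₀+1)} · |d_s|^E (|d_s|^E Λ_{s,k})^{h-1}
  < (c_Θ e^{-C'_Θ(1+s²)})^{D}` (`D = nD'`). [folklore] -/
def NumCond₂ {D' : ℕ} (ξ : UIdx β γ δ D' → 𝓞 B.K) (T S₀ S₁ T' : ℕ) (R : ℝ) : Prop :=
  ∀ s : ℕ, s ≤ S₁ → ∀ k : ℕ, k < T' →
    (k.factorial : ℝ) * ((k : ℝ) * B.dirNorm + 1) ^ k * (Fintype.card (UIdx β γ δ D') * B.houseXi ξ *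
        Real.exp (thetaGrowthC (β := β) B.L B.κM * (1 + (R * ‖B.v‖ + 1) ^ 2)) ^
          (Fintype.card (β ⊕ (γ ⊕ δ)) * D')) *
      (2 * ((s : ℝ) + S₀) / R) ^ ((T - k) * (S₀ + 1)) *
      (|(B.dAt s : ℝ)| ^ B.expE (Fintype.card (β ⊕ (γ ⊕ δ)) * D') k *
        (|(B.dAt s : ℝ)| ^ B.expE (Fintype.card (β ⊕ (γ ⊕ δ)) * D') k * B.lineValBound ξ s k) ^
          (B.gens.h - 1)) <
    (B.thetaLowc * Real.exp (-(B.thetaLowC * (1 + (s : ℝ) ^ 2)))) ^ (Fintype.card (β ⊕ (γ ⊕ δ)) * D')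

/-- **Vanishing at the new points (scaled form).** [cite: BakerWustholz2007, §6.8 (p. 119)] -/
theorem vanishesAlong_newPoints₂ (hv : B.v ∈ B.bSpan) {D' : ℕ} (ξ : UIdx β γ δ D' → 𝓞 B.K)
    {T S₀ S₁ T' : ℕ} {R : ℝ} (hR0 : 0 < R) (hR : 2 * ((S₁ : ℝ) + S₀) ≤ R)
    (hvan : ∀ s₀ : ℕ, s₀ ≤ S₀ → VanishesAlong B.bSpan (thetaEval B.L B.κM (B.auxForm ξ)) ((s₀ : ℂ) • B.v) T)
    (hnum : B.NumCond₂ ξ T S₀ S₁ T' R) {s : ℕ} (hs : s ≤ S₁) :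
    VanishesAlong B.bSpan (thetaEval B.L B.κM (B.auxForm ξ)) ((s : ℂ) • B.v) T' := by
  obtain ⟨hC0, hC⟩ := thetaGrowthC_spec (β := β) B.L B.κM
  obtain ⟨hc0, hC'0, hlow⟩ := B.thetaLow_spec
  refine B.vanishesAlong_of_small ξ s T' fun k hk cg hcg => ?_
  have hRs : 2 * ((s : ℝ) + S₀) ≤ R := by
    have : (s : ℝ) ≤ S₁ := by exact_mod_cast hs
    linarith
  have hφ := B.norm_extrapFun_grid_le₂ hC0 hC hv ξ hvan hcg s hR0 hRs
  have hΛ : 0 ≤ |(B.dAt s : ℝ)| ^ B.expE (Fintype.card (β ⊕ (γ ⊕ δ)) * D') k *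
      (|(B.dAt s : ℝ)| ^ B.expE (Fintype.card (β ⊕ (γ ⊕ δ)) * D') k * B.lineValBound ξ s k) ^ (B.gens.h - 1) := by
    have := B.lineValBound_nonneg ξ s k
    positivity
  have hΘ : (B.thetaLowc * Real.exp (-(B.thetaLowC * (1 + (s : ℝ) ^ 2)))) ^ (Fintype.card (β ⊕ (γ ⊕ δ)) * D') ≤
      ‖theta B.L B.κM (baseIdx (B.cAt s)) ((s : ℂ) • B.v)‖ ^ (Fintype.card (β ⊕ (γ ⊕ δ)) * D') :=
    pow_le_pow_left₀ (by positivity) (hlow s) _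
  calc ‖extrapFun B.L B.κM (B.auxForm ξ) B.v (B.gridDir cg) k s‖ *
        (|(B.dAt s : ℝ)| ^ B.expE (Fintype.card (β ⊕ (γ ⊕ δ)) * D') k *
          (|(B.dAt s : ℝ)| ^ B.expE (Fintype.card (β ⊕ (γ ⊕ δ)) * D') k * B.lineValBound ξ s k) ^ (B.gens.h - 1))
      ≤ _ := mul_le_mul_of_nonneg_right hφ hΛ
    _ < _ := hnum s hs k hk
    _ ≤ _ := hΘ

/-- **The Baker engine (scaled form).** `v ∈ 𝔟`, `T ≥ 1`, `(S₀+1)·T^{dd} < (D'+1)^n`, `R > 0`,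
`R ≥ 2(S₁ + S₀)`, and `NumCond₂` for every coefficient vector within the Siegel house bound
`⇒ ∃ P` homogeneous of degree `nD'`, `F_P ≢ 0`, `VanishesAlong 𝔟 F_P (s·v) T'` for `s ≤ S₁`.
[cite: BakerWustholz2007, §6.8 (pp. 118–119)] -/
theorem engine₂ (hv : B.v ∈ B.bSpan) (D' T S₀ S₁ T' : ℕ) (R : ℝ) (hT : 0 < T)
    (hpq : (S₀ + 1) * T ^ B.dd < (D' + 1) ^ Fintype.card (β ⊕ (γ ⊕ δ)))
    (hR0 : 0 < R) (hR : 2 * ((S₁ : ℝ) + S₀) ≤ R)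
    (hnum : ∀ ξ : UIdx β γ δ D' → 𝓞 B.K,
      (∀ u, house ((ξ u : 𝓞 B.K) : B.K) ≤ B.siegelHouseBound D' T S₀) → B.NumCond₂ ξ T S₀ S₁ T' R) :
    ∃ P : MvPolynomial (Option β × ThetaIdx γ δ) ℂ,
      P.IsHomogeneous (Fintype.card (β ⊕ (γ ⊕ δ)) * D') ∧
      (∃ w, thetaEval B.L B.κM P w ≠ 0) ∧
      ∀ s : ℕ, s ≤ S₁ → VanishesAlong B.bSpan (thetaEval B.L B.κM P) ((s : ℂ) • B.v) T' := by
  obtain ⟨ξ, -, hhouse, hne, hvan⟩ := B.exists_auxiliary₂ D' T S₀ hT hpq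
  refine ⟨B.auxForm ξ, isHomogeneous_homog _ _, hne, fun s hs => ?_⟩
  exact B.vanishesAlong_newPoints₂ hv ξ hR0 hR (fun s₀ hs₀ => hvan s₀ hs₀) (hnum ξ hhouse) hs

end BakerData

end Std

end GaGmE

end Literature.NumberTheory.Transcendental

end
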